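/-
Copyright (c) 2026. All rights reserved.
Released under Apache 2.0 license as described in the file LICENSE.
Authors: abc-iut cell — seat abc-iut-w6-d024 (gen 4; block C / W6, L4-lead RULING #8h row «COR27e-ORBI-TRANSPORT»,
part (A): the transport `E → Ẽ → X` read in the plane).  PROOF-ONLY — no definitions.
-/
import Literature.AnabelianGeometry.AbsoluteAnabelian.ArchimedeanReconstructionCor27fAtGermModelProofs
import HarnessLib

/-!
# [AbsTopIII] Cor 2.7 (e), last sentence, at the germ model: the transport of the local linear holomorphic
# structure from `E^top` to `X^top` is independent of the leg, of the branch and of deck transformations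

S. Mochizuki, *Topics in absolute anabelian geometry III* (bib key `MochizukiAbsTopIII2015`), Cor 2.7 (e),
kurims p.60 l.12–14: "This system of '`𝒜_p`'s' may be thought of as a system of 'local linear holomorphic
structures' on `E^top` or `X^top`" — for the diagram of (a) `X → ℍ ← E` (semi-elliptic hyperbolic core
`ℍ`, once-punctured elliptic curve `E`).  The structures of (c)–(e) are built on `E^top` and TRANSPORTED to
`X^top` through the common finite étale cover `Ẽ := E ×_ℍ X`: both legs `E ← Ẽ → X` are holomorphic
LOCAL ISOMORPHISMS (the orbifold points of `ℍ` are never crossed: near a `2`-torsion point the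
correspondence `E ⇢ X` is `z ↦ ±z`, not the coarse quotient `z ↦ z²`).

Read in the plane (abc-iut-w6-d024's germ-model rows p437330 / p440390 / p441307), a local isomorphism acts
on tangent-vector frames by its derivative `d ≠ 0` and on `𝒜_p` by "same multiplier"; this PROOF-ONLY
file records the WELL-DEFINEDNESS of the transported system, which is what "(e) on `X^top`" requires:

* `Cor27e.transport_frames_eq_of_hasDerivAt` — two holomorphic local isomorphisms `φ₁ : (V₁, p₁) → (W, x)`,
  `φ₂ : (V₂, p₂) → (W, x)` (different legs, different branches `p₁, p₂ ∈ E` over `x`, or differing by a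
  deck transformation) transport the (d)-frames to THE SAME set at `x` — namely `autHolOrthFramesAt W x`;
* `Cor27e.transport_frames_deck` — in particular an automorphism `γ` of the source disc (a deck
  transformation; the involution of `E → ℍ`) with `γ p = p'` carries the frames at `p` onto those at `p'`;
* `Cor27e.transport_germAut_eq` — the transported groups agree: the element of `𝒜_x` obtained from
  `u ∈ 𝒜_{p₁}` and from the corresponding `u' ∈ 𝒜_{p₂}` (`germAutTrans p₁ p₂ u`) coincide
  (`germAutTrans_comp`), and the transition isomorphisms of the transported system on `X^top` are
  compatible with those of `E^top` (`Cor27e.transport_trans_compat`);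
* `Cor27e.image_zero_mul_autHolOrthFramesAt`, `Cor27e.frames_ne_degenerate` — KERNEL REMARK on the
  orbifold points: derivative-transport THROUGH the coarse quotient map at a fixed point of the involution
  (`z ↦ z²`, derivative `0`) collapses the frames to `{(0, 0)}`, which is NOT the frame set of any disc — the
  structure lives on `E^top` / `X^top`, not on the coarse space of `ℍ`, exactly as print says.

No uniformisation input (abc-iut-L4-t8's UNIF-G1P) is needed at this level; the genuine-`𝔼` junction of
the local additive structure is part (B) (`HolomorphicEllipticCuspidalizationLocalAddChartProofs.lean`).
MODEL LEVEL; refereed pre-IUT material; nothing here bears on the disputed [IUTchIII] Cor. 3.12;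
typed ≠ endorsed.
-/

noncomputable section

namespace Literature.AnabelianGeometry.AbsoluteAnabelian

open _root_.TopologicalSpace _root_.Topology _root_.Set _root_.Metric _root_.Function _root_.Filter
open scoped _root_.Manifold _root_.ContDiff ComplexConjugate UpperHalfPlane MatrixGroups InnerProductSpace
open _root_.UpperHalfPlane Literature.Analysis.Complex NormedSpace _root_.Complex
open scoped Matrix.Norms.Operator

set_option backward.isDefEq.respectTransparency false

namespace Cor27e

/-! ### Independence of the leg / branch / deck transformation -/

/-- **The transported frames do not depend on the local isomorphism used.**  For planar Aut-holomorphic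
discs `V₁ ∋ p₁`, `V₂ ∋ p₂`, `W` and maps `φ₁`, `φ₂` with `HasDerivAt φᵢ dᵢ pᵢ`, `dᵢ ≠ 0`,
`φ₁ p₁ = φ₂ p₂ =: x ∈ W` (the two legs `E ← Ẽ → X`, two branches over `x`, …), the derivative-transports
of the (d)-frames at `p₁` and at `p₂` coincide (both are `autHolOrthFramesAt W x`).
[cite: MochizukiAbsTopIII2015, Corollary 2.7 (e) p.60] -/
theorem transport_frames_eq_of_hasDerivAt {V₁ V₂ W : Opens ℂ} (hV₁ : IsAutHolDisc V₁) (hV₂ : IsAutHolDisc V₂)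
    (hW : IsAutHolDisc W) (p₁ : V₁) (p₂ : V₂) {φ₁ φ₂ : ℂ → ℂ} {d₁ d₂ : ℂ}
    (h₁ : HasDerivAt φ₁ d₁ p₁) (h₂ : HasDerivAt φ₂ d₂ p₂) (hd₁ : d₁ ≠ 0) (hd₂ : d₂ ≠ 0)
    (hx₁ : φ₁ p₁ ∈ (W : Set ℂ)) (hx : φ₂ p₂ = φ₁ p₁) :
    (fun e : ℂ × ℂ => (d₁ * e.1, d₁ * e.2)) '' autHolOrthFramesAt V₁ p₁ =
      (fun e : ℂ × ℂ => (d₂ * e.1, d₂ * e.2)) '' autHolOrthFramesAt V₂ p₂ := by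
  have hx₂ : φ₂ p₂ ∈ (W : Set ℂ) := hx ▸ hx₁
  rw [Cor27f.autHolOrthFramesAt_transport_of_hasDerivAt hV₁ hW p₁ h₁ hd₁ hx₁,
    Cor27f.autHolOrthFramesAt_transport_of_hasDerivAt hV₂ hW p₂ h₂ hd₂ hx₂]
  congr 1
  exact Subtype.ext hx.symm

/-- **Deck transformations / the involution of `E → ℍ`**: an automorphism `γ` of the source disc `V`
(`HasDerivAt γ c p`, `c ≠ 0`, `γ p = p' ∈ V`) carries the (d)-frames at `p` onto the (d)-frames at `p'`
(by its derivative), so the transported system is invariant under the deck group of `Ẽ → X`.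
[cite: MochizukiAbsTopIII2015, Corollary 2.7 (e) p.60] -/
theorem transport_frames_deck {V : Opens ℂ} (hV : IsAutHolDisc V) (p : V) {γ : ℂ → ℂ} {c : ℂ}
    (hγ : HasDerivAt γ c p) (hc : c ≠ 0) (hp' : γ p ∈ (V : Set ℂ)) :
    (fun e : ℂ × ℂ => (c * e.1, c * e.2)) '' autHolOrthFramesAt V p = autHolOrthFramesAt V ⟨γ p, hp'⟩ :=
  Cor27f.autHolOrthFramesAt_transport_of_hasDerivAt hV hV p hγ hc hp'

open LocGerm in
/-- **The transported groups `𝒜_x` agree.**  Transporting `u ∈ 𝒜_{p₁}` to `x` ("same multiplier",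
`germAutTrans p₁ x`) gives the same element as first passing to the corresponding `u' ∈ 𝒜_{p₂}` over the
other branch / leg (`germAutTrans p₁ p₂ u`, Prop 2.6 (b)) and then transporting (`germAutTrans p₂ x`) —
abc-iut-w4-d104's `germAutTrans_comp`; and the result lies in the `𝕎`-cut-out group at `x`.
[cite: MochizukiAbsTopIII2015, Corollary 2.7 (e) p.60] -/
theorem transport_germAut_eq {W : Opens ℂ} (hW : IsAutHolDisc W) (p₁ p₂ : ℂ) (x : W) (u : germAut p₁) :
    germAutTrans p₂ (x : ℂ) (germAutTrans p₁ p₂ u) = germAutTrans p₁ (x : ℂ) u ∧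
      ((germAutTrans p₁ (x : ℂ) u : germAut (x : ℂ)) : (LocGerm (x : ℂ))ˣ) ∈ germAutFromAutHol W x := by
  refine ⟨?_, ?_⟩
  · rw [← ContinuousMulEquiv.trans_apply, germAutTrans_comp]
  · rw [cor27eGermAutFromAutHol_holds W hW x]
    exact (germAutTrans p₁ (x : ℂ) u).2

/-- **Compatibility of the transition isomorphisms** ("together with compatible isomorphisms
`𝒜_p ⥲ 𝒜_{p'}`"): for lifts `p, p'` (in `E^top`) of `x, x'` (in `X^top`), transporting at `x`, moving by
the transition of the transported system `𝒜_x ⥲ 𝒜_{x'}` and transporting back at `x'` IS the transition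
`𝒜_p ⥲ 𝒜_{p'}` of `E^top` — all four are "same multiplier".
[cite: MochizukiAbsTopIII2015, Corollary 2.7 (e) p.60] -/
theorem transport_trans_compat (p p' x x' : ℂ) (u : germAut p) :
    (germAutTrans x' p') (germAutTrans x x' (germAutTrans p x u)) = germAutTrans p p' u := by
  rw [← ContinuousMulEquiv.trans_apply, ← ContinuousMulEquiv.trans_apply, germAutTrans_comp,
    germAutTrans_comp]

/-! ### The orbifold points of `ℍ`: why the structure is not transported through the coarse quotient -/

/-- Derivative-transport through a map with VANISHING derivative (the coarse quotient `z ↦ z²` of the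
involution of `E → ℍ` at a `2`-torsion point) collapses every frame set to `{(0, 0)}`.
[cite: MochizukiAbsTopIII2015, Corollary 2.7 (e) p.60] -/
theorem image_zero_mul_autHolOrthFramesAt {V : Opens ℂ} (hV : IsAutHolDisc V) (p : V) :
    (fun e : ℂ × ℂ => ((0 : ℂ) * e.1, (0 : ℂ) * e.2)) '' autHolOrthFramesAt V p = {((0 : ℂ), (0 : ℂ))} := by
  ext e
  simp only [Set.mem_image, zero_mul, Set.mem_singleton_iff]
  constructor
  · rintro ⟨_, _, rfl⟩; rfl
  · rintro rfl; exact ⟨((0 : ℂ), (0 : ℂ)), zero_mem_autHolOrthFramesAt V hV p, rfl⟩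

/-- … and `{(0, 0)}` is NOT the frame set of any point of any planar Aut-holomorphic disc (`(1, i)` is a
frame everywhere): the (d)/(e) structure lives on `E^top` / `X^top`, not on the coarse space of `ℍ`.
[cite: MochizukiAbsTopIII2015, Corollary 2.7 (e) p.60] -/
theorem frames_ne_degenerate {W : Opens ℂ} (hW : IsAutHolDisc W) (x : W) :
    autHolOrthFramesAt W x ≠ {((0 : ℂ), (0 : ℂ))} := by
  intro h
  have h1 : ((1 : ℂ), Complex.I) ∈ autHolOrthFramesAt W x :=
    (mem_autHolOrthFramesAt_iff W hW x _).2 (Or.inr ⟨one_ne_zero, Complex.I_ne_zero, by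
      simp [Complex.inner]⟩)
  rw [h, Set.mem_singleton_iff, Prod.mk.injEq] at h1
  exact one_ne_zero h1.1

end Cor27e

end Literature.AnabelianGeometry.AbsoluteAnabelian

end
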